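import Literature.Geometry.Kaehler.TorusTransferOps
import HarnessLib

/-!
# The frozen symbol of a transferred chart operator and ellipticity from a scalar symbol (Warner 6.28–6.29)

F. W. Warner, GTM 94 (1983), 6.28 (ellipticity: `|P_l(ξ) u|² ≥ c |ξ|^{2l} |u|²`) and 6.29 (the
fundamental inequality for periodic elliptic operators with almost-constant principal part). For a
chart operator `Q` transferred to the torus (`ChartOp1.toFOp1` of `TorusTransferOps`):

* `freqCovector A k = ∑ k_j ℓ_j` — the real covector of the integer frequency `k` in the cube
  coordinates, and `ChartOp1.symbol_toPOp1_toFOp1`: the lattice symbol of the frozen part of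
  `Q.toFOp1` at frequency `k` is `v ↦ ι' (B y₀ (ξ_k ⊗ ι⁻¹ v))`;
* `norm_toDual_symm_freqCovector_ge` — `‖ξ_k♯‖²_{g_p} ≥ C |k|²` with `C > 0` (the frequency map
  is injective; finite dimension);
* `Lattice.POp.isEllipticWith_of_symbol_eq_neg_smul` — a lattice operator whose symbol is the scalar
  `-c(k)` with `c(k) ≥ κ |k|²` is elliptic with constant `κ` (Warner 6.28).

## References

* F. W. Warner, GTM 94 (1983), 6.28, 6.29. [WarnerGTM94]
-/

noncomputable section

open scoped Manifold ContDiff Topology NNReal ENNReal RealInnerProductSpace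
open Bundle Set Function Module Metric
open Literature.Analysis.FunctionSpaces

set_option maxSynthPendingDepth 2

namespace Literature.Geometry.Kaehler

/-! ### The frequency covector -/

section Freq

variable {E : Type*} [NormedAddCommGroup E] [NormedSpace ℝ E] {n : ℕ}
  {Λ : Type*} [NormedAddCommGroup Λ] [NormedSpace ℝ Λ]

/-- **The frequency covector** `ξ_k = ∑_j k_j ℓ_j` of an integer frequency `k` in the cube
coordinates of `A`. [cite: WarnerGTM94, 6.28] -/
def freqCovector (A : E ≃L[ℝ] EuclideanSpace ℝ (Fin n)) (kv : Fin n → ℤ) : E →L[ℝ] ℝ :=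
  ∑ j, (kv j : ℝ) • cubeCoord A j

/-- Values of the frequency covector. [folklore] -/
theorem freqCovector_apply (A : E ≃L[ℝ] EuclideanSpace ℝ (Fin n)) (kv : Fin n → ℤ) (v : E) :
    freqCovector A kv v = ∑ j, (kv j : ℝ) * A v j := by
  simp [freqCovector]

/-- `smulRight` is linear in the functional: sums. [folklore] -/
theorem sum_smulRight_left {ι : Type*} (s : Finset ι) (ℓ : ι → E →L[ℝ] ℝ) (a : Λ) :
    (∑ i ∈ s, ℓ i).smulRight a = ∑ i ∈ s, (ℓ i).smulRight a := by
  ext v; simp [Finset.sum_smul]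

/-- `smulRight` is linear in the functional: scalars. [folklore] -/
theorem smul_smulRight_left (c : ℝ) (ℓ : E →L[ℝ] ℝ) (a : Λ) : (c • ℓ).smulRight a = c • ℓ.smulRight a := by
  ext v; simp [mul_smul]

/-- The frequency covector tensored with `a`, expanded. [folklore] -/
theorem freqCovector_smulRight (A : E ≃L[ℝ] EuclideanSpace ℝ (Fin n)) (kv : Fin n → ℤ) (a : Λ) :
    (freqCovector A kv).smulRight a = ∑ j, (kv j : ℝ) • (cubeCoord A j).smulRight a := by
  rw [freqCovector, sum_smulRight_left]
  exact Finset.sum_congr rfl fun j _ ↦ smul_smulRight_left _ _ _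

/-- The frequency covector evaluated on `A⁻¹ k` is `|k|²`. [folklore] -/
theorem freqCovector_apply_symm (A : E ≃L[ℝ] EuclideanSpace ℝ (Fin n)) (kv : Fin n → ℤ) :
    freqCovector A kv (A.symm (WithLp.toLp 2 fun j ↦ (kv j : ℝ))) = Torus.freqNormSq kv := by
  rw [freqCovector_apply, Torus.freqNormSq]
  refine Finset.sum_congr rfl fun j _ ↦ ?_
  rw [ContinuousLinearEquiv.apply_symm_apply, PiLp.toLp_apply, pow_two]

/-- The Euclidean norm of the real frequency vector is `|k|`. [folklore] -/
theorem norm_toLp_freq_sq (kv : Fin n → ℤ) : ‖(WithLp.toLp 2 fun j ↦ (kv j : ℝ) : EuclideanSpace ℝ (Fin n))‖ ^ 2 =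
    Torus.freqNormSq kv := by
  rw [EuclideanSpace.norm_sq_eq, Torus.freqNormSq]
  exact Finset.sum_congr rfl fun j _ ↦ by simp

end Freq

/-! ### The lattice symbol of a transferred chart operator -/

section Symbol

variable {E : Type*} [NormedAddCommGroup E] [NormedSpace ℝ E] {n : ℕ}
  {M : Type*} [TopologicalSpace M] [ChartedSpace E M]
  {F F' : Type*} [NormedAddCommGroup F] [NormedSpace ℂ F] [NormedAddCommGroup F'] [NormedSpace ℂ F']
  {k k' : ℕ}
  {V W : Type*} [NormedAddCommGroup V] [NormedSpace ℂ V] [NormedAddCommGroup W] [NormedSpace ℂ W]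
  [FiniteDimensional ℂ V] [FiniteDimensional ℂ W]
  {Q : ChartOp1 E F F' k k'} {p : M} {A : E ≃L[ℝ] EuclideanSpace ℝ (Fin n)}
  {ι : (E [⋀^Fin k]→L[ℝ] F) ≃L[ℂ] V} {ι' : (E [⋀^Fin k']→L[ℝ] F') ≃L[ℂ] W}

/-- Integer frequencies as complex and as real scalars on a complex space. [folklore] -/
theorem intCast_smul_eq_realCast_smul {X : Type*} [AddCommGroup X] [Module ℂ X] (z : ℤ) (x : X) :
    (z : ℂ) • x = ((z : ℝ) : ℂ) • x := by
  norm_cast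

/-- **The frozen lattice symbol of a transferred chart operator**: at frequency `k` it is
`v ↦ ι' (B(y₀) (ξ_k ⊗ ι⁻¹ v))` with the frequency covector `ξ_k`. [cite: WarnerGTM94, 6.28] -/
theorem ChartOp1.symbol_toPOp1_toFOp1 (𝒞 : CubeCutoff p A) (hQ : Q.SmoothOn (extChartAt 𝓘(ℝ, E) p).target)
    (hBI : ∀ y D, Q.B y (Complex.I • D) = Complex.I • Q.B y D)
    (hCI : ∀ y a, Q.C y (Complex.I • a) = Complex.I • Q.C y a) (kv : Fin n → ℤ) (v : V) :
    (Q.toFOp1 A ι ι' 𝒞 hQ hBI hCI).toPOp1.symbol kv v =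
      ι' (Q.B (extChartAt 𝓘(ℝ, E) p p) ((freqCovector A kv).smulRight (ι.symm v))) := by
  rw [freqCovector_smulRight, map_sum, map_sum]
  simp only [Lattice.POp1.symbol, FunLike.coe_sum, Finset.sum_apply, FunLike.coe_smul,
    Pi.smul_apply, Torus.FOp1.toPOp1_P, ChartOp1.toFOp1_P, ChartOp1.dirCoeff_apply]
  refine Finset.sum_congr rfl fun j _ ↦ ?_
  rw [intCast_smul_eq_realCast_smul, map_smul, ← Complex.coe_smul, LinearMapClass.map_smul]

end Symbol

/-! ### Ellipticity from a scalar symbol -/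

section Elliptic

variable {d : Type*} [Fintype d] {V : Type*} [NormedAddCommGroup V] [NormedSpace ℂ V]

/-- **A lattice operator with scalar symbol `-c(k)`, `c(k) ≥ κ |k|²`, is elliptic with constant
`κ`** (Warner 6.28: `|P(ξ) u| ≥ c^{1/2} |ξ|^l |u|`). [cite: WarnerGTM94, 6.28] -/
theorem _root_.Literature.Analysis.FunctionSpaces.Lattice.POp.isEllipticWith_of_symbol_eq_neg_smul
    (L : Lattice.POp d V V) {c : (d → ℤ) → ℝ} {κ : ℝ}
    (hL : ∀ (kv : d → ℤ) (v : V), L.symbol kv v = -((c kv : ℂ) • v))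
    (hc : ∀ kv, κ * Torus.freqNormSq kv ≤ c kv) (hc0 : ∀ kv, 0 ≤ c kv) : L.IsEllipticWith κ := by
  intro kv v
  rw [hL, norm_neg, norm_smul, Complex.norm_real, Real.norm_of_nonneg (hc0 kv)]
  exact mul_le_mul_of_nonneg_right (hc kv) (norm_nonneg v)

end Elliptic

/-! ### The frequency covector is bounded below in the metric of the tangent space -/

section LowerBound

variable {E : Type*} [NormedAddCommGroup E] [NormedSpace ℝ E] [FiniteDimensional ℝ E] {n : ℕ}
  {H : Type*} [TopologicalSpace H] {I : ModelWithCorners ℝ E H}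
  {M : Type*} [TopologicalSpace M] [ChartedSpace H M]
  [RiemannianBundle (fun x : M ↦ TangentSpace I x)]

/-- **`‖ξ_k♯‖²_{g_p} ≥ C |k|²` with `C > 0`**: the frequency covectors, read as covectors on the
tangent space at `p` with its metric, are bounded below by the Euclidean norm of the frequency
(test vector `A⁻¹ k`, on which `ξ_k` takes the value `|k|²`). [cite: WarnerGTM94, 6.28] -/
theorem norm_toDual_symm_freqCovector_ge (p : M) (A : E ≃L[ℝ] EuclideanSpace ℝ (Fin n)) :
    ∃ C : ℝ, 0 < C ∧ ∀ kv : Fin n → ℤ, C * Torus.freqNormSq kv ≤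
      ‖(InnerProductSpace.toDual ℝ (TangentSpace I p)).symm (freqCovector A kv)‖ ^ 2 := by
  -- the identity `E → T_p M` as a bounded map between the two norms
  set T : E →L[ℝ] TangentSpace I p := LinearMap.toContinuousLinearMap (LinearMap.id : E →ₗ[ℝ] TangentSpace I p)
    with hT
  set C₀ : ℝ := ‖T‖ * ‖(A.symm : EuclideanSpace ℝ (Fin n) →L[ℝ] E)‖ with hC₀
  have hC₀' : 0 ≤ C₀ := by positivity
  refine ⟨1 / (C₀ + 1) ^ 2, by positivity, fun kv ↦ ?_⟩
  set r : EuclideanSpace ℝ (Fin n) := WithLp.toLp 2 fun j ↦ (kv j : ℝ) with hr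
  set ξ : TangentSpace I p →L[ℝ] ℝ := freqCovector A kv with hξ
  have hnorm : ‖(InnerProductSpace.toDual ℝ (TangentSpace I p)).symm (freqCovector A kv)‖ = ‖ξ‖ :=
    LinearIsometryEquiv.norm_map _ _
  -- the test vector
  set w : TangentSpace I p := T (A.symm r) with hw
  have hval : ξ w = ‖r‖ ^ 2 := by
    rw [norm_toLp_freq_sq]
    exact freqCovector_apply_symm A kv
  have hwle : ‖w‖ ≤ C₀ * ‖r‖ := by
    calc ‖w‖ ≤ ‖T‖ * ‖A.symm r‖ := T.le_opNorm _
      _ ≤ ‖T‖ * (‖(A.symm : EuclideanSpace ℝ (Fin n) →L[ℝ] E)‖ * ‖r‖) :=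
        mul_le_mul_of_nonneg_left ((A.symm : EuclideanSpace ℝ (Fin n) →L[ℝ] E).le_opNorm r) (norm_nonneg _)
      _ = C₀ * ‖r‖ := by rw [hC₀]; ring
  have h1 : ‖r‖ ^ 2 ≤ ‖ξ‖ * (C₀ * ‖r‖) := by
    calc ‖r‖ ^ 2 = ξ w := hval.symm
      _ ≤ ‖ξ w‖ := Real.le_norm_self _
      _ ≤ ‖ξ‖ * ‖w‖ := ξ.le_opNorm w
      _ ≤ ‖ξ‖ * (C₀ * ‖r‖) := mul_le_mul_of_nonneg_left hwle (norm_nonneg _)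
  have h2 : ‖r‖ ≤ (C₀ + 1) * ‖ξ‖ := by
    by_cases hr0 : ‖r‖ = 0
    · rw [hr0]; positivity
    · have hrpos : 0 < ‖r‖ := lt_of_le_of_ne (norm_nonneg _) (Ne.symm hr0)
      have h3 : ‖r‖ ≤ ‖ξ‖ * C₀ := by
        have := h1; rw [pow_two] at this; nlinarith
      nlinarith [norm_nonneg ξ]
  rw [hnorm, ← norm_toLp_freq_sq, ← hr]
  have h4 : ‖r‖ ^ 2 ≤ (C₀ + 1) ^ 2 * ‖ξ‖ ^ 2 := by
    rw [← mul_pow]; exact pow_le_pow_left₀ (norm_nonneg _) h2 2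
  rw [div_mul_eq_mul_div, one_mul, div_le_iff₀ (by positivity)]
  linarith

end LowerBound

end Literature.Geometry.Kaehler
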